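import Mathlib
import HarnessLib
import Summits.Langlands.Statement
import Literature.NumberTheory.GaloisRepresentations.LabelledHodgeTateWeights
import Literature.NumberTheory.PAdicHodge.FontaineDpst
import Summits.Langlands.Langlands.Theses.WeightMultiplicitySplit
import Summits.Langlands.Langlands.Theorems.WeightMultiplicitySplitWallWeightReciprocityOfSplit
import Summits.Langlands.Langlands.Theorems.WeightMultiplicitySplitDegenerateWeightReciprocityOfSplit
import Summits.Langlands.Langlands.Theorems.WeightMultiplicitySplitMinusculeHodgeType

set_option linter.dupNamespace false

/-!
# WeightMultiplicitySplitDegenerateWindow (tree twin of the lens-2-g15 node `DegenerateWindowSplit`; statement-and-kernel support module for stmt-Langlands-33709) — decomp-langlands lens-2 gen 15 (structural dichotomy «special vs generic», RESIDUAL MODE, BLOCKER FIRST)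

NODE TARGET (never re-typed; text of record = the tree's `Theses/Summit.Langlands.Langlands.Theses.WeightMultiplicitySplit.lean` rev 2, imported, used BY NAME):
* D_Prim = `Summit.Langlands.Langlands.Theses.WeightMultiplicitySplit.DegenerateLieIrreducibleAutomorphy` (stmt-Langlands-33709, crux r404, OPEN, LAYER-2 child of D =
  `DegenerateWeightReciprocity` 24356 by the g10 split, DECLARED RESIDUAL of the DEGENERATE chamber «some labelled Hodge–Tate weight of
  multiplicity ≥ 3»): GIVEN reciprocity below rank n (the tree's `GlobalLanglandsCorrespondenceGLn m L RdL hcptL` for all m < n; `ReciprocityBelow n`,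
  `Iff.rfl`), direction (B) «Galois ⟹ automorphic» with FULL `Summit.Langlands.Corresponds` for the irreducible pinned-geometric ρ : Γ_F → GL_n(ℚ̄_ℓ)
  of DEGENERATE Hodge–Tate type with PRIMITIVE INFINITE monodromy (Lie-irreducible, not potentially scalar) — every number field F, n, datum, level, ℓ, ι.

THE CUT = the two LOW-RANK ACCIDENTAL ISOGENIES B₂ = C₂ (𝔰𝔬₅ ≅ 𝔰𝔭₄) and D₃ = A₃ (𝔰𝔬₆ ≅ 𝔰𝔩₄), read on the bound ρ as F-RATIONAL PLETHYSM WINDOWS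
through a rank-4 avatar σ (whose reciprocity the IH owns), typed on characteristic polynomials over existing declarations (no new tree declaration):
    SPIN `IsSpinorWindow Rd ρ`         :⟺ n = 5 ∧ ∃ σ (rank 4: irreducible, pinned-geometric, Lie-irreducible) ∃ ψ ν (pinned-geometric characters),
                                           ∀ g, ψ(g)·roots(charpoly ρ g) + {ν(g)} = {pairwise products of roots(charpoly σ g)}   (⟺ (ρ ⊗ ψ) ⊕ ν ≅ ∧²σ)
    ACC  `IsExteriorSquareWindow Rd ρ` :⟺ n = 6 ∧ ∃ σ (same) ∃ χ (pinned-geometric character),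
                                           ∀ g, roots(charpoly ρ g) = χ(g)·{pairwise products of roots(charpoly σ g)}            (⟺ ρ ≅ ∧²σ ⊗ χ)
  In the degenerate chamber these windows are the classical K3-type accidents (HT weights of ∧²σ = pairwise sums; §2 certificates).
  Cells (each = D_Prim's text VERBATIM with ONE extra conjunct on the bound ρ; all keep the IH antecedent):
    SPIN `DegenerateSpinorWindowTransport` — ATTACKABLE-NOW (print mod IH): IH(σ rank 4; ψ, ν rank 1) + Kim 2003 ∧² GL₄ → GL₆ (tree fact) + Henniart 2009 (local ∧²-lift
      at every place) + GL₁-splitting ∧²π₄ = Π₅ ⊞ ν + Asgari–Raghuram 2007 cuspidality (tree fact) + WD(∧²) = ∧²WD / D_pst — THE ATTACKED CONJUNCT;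
    ACC `DegenerateExteriorSquareWindowTransport` — ATTACKABLE-NOW (print mod IH), same engine without the splitting step;
    RES `WindowlessDegenerateAutomorphy` — ¬SPIN ∧ ¬ACC (abelian g-folds g ≥ 3, K3 type of rank ≥ 7, CY threefolds, irregular unitary type, non-accidental Lie types):
      BARRIER (NonRegularWeight head-on) · IDEA-NEEDED = DECLARED RESIDUAL.
  FRAME `DegenerateLieIrreducibleFrame` := D_Prim → Langlands (support; content = the HOST ROUTE around D_Prim, certified here from the host's `closes`,
  BOTH LANDED glues `Theorems.WeightMultiplicitySplit_WallWeightReciprocity_of_split_proof` (33607) / `…_DegenerateWeightReciprocity_of_split_proof`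
  (33711) and the host items BY NAME: `frame_of_host`, `frame_of_host_leaves`).

KERNEL (all mod NOTHING):  D_Prim ⟺ SPIN ∧ ACC ∧ RES (`degenerateLieIrreducible_iff_cells`, excluded middle on the two inlined dials) · each cell ⟸ D_Prim ⟸ Langlands (`cells_of_degenerateLieIrreducible`, `…_of_langlands`) · Langlands ⟺ (SPIN ∧ ACC ∧ RES) ∧ FRAME
(`langlands_iff_pieces`) · `closes : SPIN → ACC → RES → FRAME → Langlands` (= the child route's deciding theorem, `childroute.glue.lean` VERBATIM) ·
`frame_of_host : G → W → D_A → D_Fin → D_Str → FRAME`, `frame_of_host_leaves : G → W_A → W_Fin → W_Str → W_Prim → D_A → D_Fin → D_Str → FRAME`.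
Orbit/saturation of the dials: memo §4 (charpoly-level, twist/dual/ℓ-change invariant; deliberately not saturated under restriction).
See the memo `DegenerateWindowSplit.md` for tags, booked print loci, barrier placement and the census.
-/

namespace Summit.Langlands.Langlands.Theorems.WeightMultiplicitySplitDegenerateWindow

open scoped BigOperators Matrix

/-! ## 1. Vocabulary (structured forms; the ITEMS below are the inlined one-liners, tied to these by `Iff.rfl`) -/

section Vocabulary

variable {F : Type} [Field F] [NumberField F] {n : ℕ} {ℓ : ℕ} [Fact ℓ.Prime]

/-- labelled Hodge–Tate weight multiplicity ≤ k for Fontaine's PINNED datum (g0/g10/g11 `HodgeTateMultLE` VERBATIM). [cite: CalegariGeraghty2017, §1] -/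
def HodgeTateMultLE (k : ℕ) (ρ : Literature.NumberTheory.GaloisRepresentations.FramedGaloisRep F (PadicAlgCl ℓ) n) : Prop :=
  ∀ (v : IsDedekindDomain.HeightOneSpectrum (NumberField.RingOfIntegers F)) (hv : ((ℓ : ℕ) : NumberField.RingOfIntegers F) ∈ v.asIdeal)
    (τ : v.adicCompletion F →+* PadicAlgCl ℓ), Continuous τ → ∀ w : ℤ,
      (ρ.labelledHodgeTateWeightsAt v (Literature.NumberTheory.PAdicHodge.fontainePstAdicCompletion v ℓ hv).algebra
        (Literature.NumberTheory.PAdicHodge.fontainePstAdicCompletion v ℓ hv).𝔅 τ).count w ≤ k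

/-- DEGENERATE Hodge–Tate type (m ≥ 3; g10 VERBATIM): some labelled weight has multiplicity ≥ 3. -/
def IsDegenerateHT (ρ : Literature.NumberTheory.GaloisRepresentations.FramedGaloisRep F (PadicAlgCl ℓ) n) : Prop :=
  ¬ HodgeTateMultLE 2 ρ

/-- **Lie-irreducible** (g2/g10 VERBATIM, any rank k): irreducible on Γ_L for EVERY number field L ⊇ F. [ref: arXiv:1207.6724, §1] -/
def IsLieIrreducible {k : ℕ} (ρ : Literature.NumberTheory.GaloisRepresentations.FramedGaloisRep F (PadicAlgCl ℓ) k) : Prop :=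
  ∀ (L : Type) [Field L] [NumberField L] [Algebra F L], (ρ.restrictField L).toGaloisRep.IsIrreducible

/-- **Potentially scalar** = finite projective image = Artin type up to twist (g2/g10 VERBATIM). [ref: arXiv:1207.6724, Prop. 4.1.1] -/
def HasFiniteProjectiveImage (ρ : Literature.NumberTheory.GaloisRepresentations.FramedGaloisRep F (PadicAlgCl ℓ) n) : Prop :=
  ∃ (L : Type) (_ : Field L) (_ : NumberField L) (_ : Algebra F L),
    ∀ σ : Field.absoluteGaloisGroup L, ∃ c : PadicAlgCl ℓ,
      ((ρ.restrictField L σ : GL (Fin n) (PadicAlgCl ℓ)) : Matrix (Fin n) (Fin n) (PadicAlgCl ℓ)) =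
        c • (1 : Matrix (Fin n) (Fin n) (PadicAlgCl ℓ))

/-- **Primitive infinite monodromy** (g10 VERBATIM): Lie-irreducible and not potentially scalar. -/
def IsPrimitiveInfinite (ρ : Literature.NumberTheory.GaloisRepresentations.FramedGaloisRep F (PadicAlgCl ℓ) n) : Prop :=
  ¬ HasFiniteProjectiveImage ρ ∧ IsLieIrreducible ρ

/-- a RANK-4 WINDOW AVATAR: irreducible, pinned-geometric (the summit's `IsGeometricFramed Rd`), Lie-irreducible — exactly the population the IH
(reciprocity at rank 4 < n, both clauses, every number field) speaks about, with the Lie-irreducibility that feeds the Asgari–Raghuram criterion. -/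
def IsWindowAvatar (Rd : Summit.Langlands.ReciprocityData F)
    (σ : Literature.NumberTheory.GaloisRepresentations.FramedGaloisRep F (PadicAlgCl ℓ) 4) : Prop :=
  σ.toGaloisRep.IsIrreducible ∧ Summit.Langlands.IsGeometricFramed Rd σ ∧ IsLieIrreducible σ

/-- **THE g15 DIAL (i) — the symplectic-spinor window B₂ = C₂** (NEW): n = 5 and, F-RATIONALLY, (ρ ⊗ ψ) ⊕ ν ≅ ∧²σ for a rank-4 window avatar σ and
pinned-geometric characters ψ, ν, typed on characteristic polynomials: ψ(g)·roots(charpoly ρ(g)) + {ν(g)} = pairwise products of roots(charpoly σ(g)),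
every g ∈ Γ_F (Brauer–Nesbitt turns the eigenvalue identity into the isomorphism of semisimplifications).  On paper: G°(σ) ⊆ GSp₄ with similitude ν, ρ the
5-dimensional standard / ∧²₀ transport of σ up to twist — the Kummer / Picard-rank-17 K3-type accident SO(2,3) ≅ Sp₄(ℝ)/±.
[cite: Kim2003, Thm. A] [ref: doi:10.17323/1609-4514-2009-9-1-33-45, Thm. 1 (Henniart 2009)]
[ref: book:laza2013-arithmetic-geometry-k3-surfaces-calabi-yau-threefolds, p. 536 (Kudla: accidental isomorphisms for lattice-polarised K3)] -/
def IsSpinorWindow (Rd : Summit.Langlands.ReciprocityData F)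
    (ρ : Literature.NumberTheory.GaloisRepresentations.FramedGaloisRep F (PadicAlgCl ℓ) n) : Prop :=
  n = 5 ∧ ∃ (σ : Literature.NumberTheory.GaloisRepresentations.FramedGaloisRep F (PadicAlgCl ℓ) 4)
    (ψ ν : Literature.NumberTheory.GaloisRepresentations.FramedGaloisRep F (PadicAlgCl ℓ) 1),
    IsWindowAvatar Rd σ ∧ (Summit.Langlands.IsGeometricFramed Rd ψ ∧ Summit.Langlands.IsGeometricFramed Rd ν) ∧
      ∀ g : Field.absoluteGaloisGroup F,
        (Literature.NumberTheory.GaloisRepresentations.FramedRep.charpoly ρ g).roots.map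
            (fun x => Literature.NumberTheory.GaloisRepresentations.FramedRep.trace ψ g * x) +
          {Literature.NumberTheory.GaloisRepresentations.FramedRep.trace ν g} =
        ((Literature.NumberTheory.GaloisRepresentations.FramedRep.charpoly σ g).roots.powersetCard 2).map Multiset.prod

/-- **THE g15 DIAL (ii) — the Plücker / exterior-square window D₃ = A₃** (NEW): n = 6 and, F-RATIONALLY, ρ ≅ ∧²σ ⊗ χ for a rank-4 window avatar σ and a
pinned-geometric character χ, typed on characteristic polynomials: roots(charpoly ρ(g)) = χ(g)·{pairwise products of roots(charpoly σ(g))}, every g ∈ Γ_F.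
On paper: the Picard-rank-16 K3-type accident SO(2,4) ≅ SU(2,2)/± and every other Lie-irreducible twisted ∧²-image of degenerate Hodge–Tate type.
[cite: Kim2003, Thm. A] [cite: AsgariRaghuram2007, Thm. 1.1] [ref: book:laza2013-arithmetic-geometry-k3-surfaces-calabi-yau-threefolds, p. 536] -/
def IsExteriorSquareWindow (Rd : Summit.Langlands.ReciprocityData F)
    (ρ : Literature.NumberTheory.GaloisRepresentations.FramedGaloisRep F (PadicAlgCl ℓ) n) : Prop :=
  n = 6 ∧ ∃ (σ : Literature.NumberTheory.GaloisRepresentations.FramedGaloisRep F (PadicAlgCl ℓ) 4)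
    (χ : Literature.NumberTheory.GaloisRepresentations.FramedGaloisRep F (PadicAlgCl ℓ) 1),
    IsWindowAvatar Rd σ ∧ Summit.Langlands.IsGeometricFramed Rd χ ∧
      ∀ g : Field.absoluteGaloisGroup F,
        (Literature.NumberTheory.GaloisRepresentations.FramedRep.charpoly ρ g).roots =
          (((Literature.NumberTheory.GaloisRepresentations.FramedRep.charpoly σ g).roots.powersetCard 2).map Multiset.prod).map
            (fun x => Literature.NumberTheory.GaloisRepresentations.FramedRep.trace χ g * x)

/-- no window at all (the residual's dial). -/
def IsWindowless (Rd : Summit.Langlands.ReciprocityData F)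
    (ρ : Literature.NumberTheory.GaloisRepresentations.FramedGaloisRep F (PadicAlgCl ℓ) n) : Prop :=
  ¬ IsSpinorWindow Rd ρ ∧ ¬ IsExteriorSquareWindow Rd ρ

/-- the two windows are mutually exclusive (rank 5 ≠ rank 6) … -/
theorem not_spinor_and_exteriorSquare (Rd : Summit.Langlands.ReciprocityData F)
    (ρ : Literature.NumberTheory.GaloisRepresentations.FramedGaloisRep F (PadicAlgCl ℓ) n) :
    ¬ (IsSpinorWindow Rd ρ ∧ IsExteriorSquareWindow Rd ρ) := by
  rintro ⟨⟨h5, -⟩, ⟨h6, -⟩⟩; omega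

/-- … and together with the residual dial the three are exhaustive and pairwise exclusive (pure logic: the cut is a partition of D_Prim's instances). -/
theorem window_trichotomy (Rd : Summit.Langlands.ReciprocityData F)
    (ρ : Literature.NumberTheory.GaloisRepresentations.FramedGaloisRep F (PadicAlgCl ℓ) n) :
    (IsSpinorWindow Rd ρ ∨ IsExteriorSquareWindow Rd ρ ∨ IsWindowless Rd ρ) ∧
      ¬ (IsSpinorWindow Rd ρ ∧ IsWindowless Rd ρ) ∧ ¬ (IsExteriorSquareWindow Rd ρ ∧ IsWindowless Rd ρ) ∧
        ¬ (IsSpinorWindow Rd ρ ∧ IsExteriorSquareWindow Rd ρ) := by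
  refine ⟨?_, fun h => h.2.1 h.1, fun h => h.2.2 h.1, not_spinor_and_exteriorSquare Rd ρ⟩
  by_cases h5 : IsSpinorWindow Rd ρ
  · exact Or.inl h5
  · by_cases h6 : IsExteriorSquareWindow Rd ρ
    · exact Or.inr (Or.inl h6)
    · exact Or.inr (Or.inr ⟨h5, h6⟩)

end Vocabulary

/-! ## 2. Certificates on the plethysm.  The labelled Hodge–Tate weights of ∧²σ are the PAIRWISE SUMS of those of σ (D_HT is a ⊗-functor), so a window
opened on a rank-4 avatar of abelian-surface / (k,2) type {a,a,c,c} — a WALL type (multiplicity 2, the IH's and W's world) — lands in the DEGENERATE chamber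
(multiplicity 4, resp. 3 after removing ν): the windows are populated by degenerate ρ whose avatars live strictly below, which is why the IH closes them. -/

section Certificates

/-- pairwise sums of a multiset of integers (the Hodge–Tate type of ∧², given that of the avatar). -/
def pairSums (s : Multiset ℤ) : Multiset ℤ := (s.powersetCard 2).map Multiset.sum

/-- six pairwise sums on a rank-4 avatar (the rank clause n = 6 of ACC; n = 5 of SPIN after removing ν). -/
theorem card_pairSums_four (s : Multiset ℤ) (hs : Multiset.card s = 4) : Multiset.card (pairSums s) = 6 := by
  simp [pairSums, Multiset.card_powersetCard, hs]; rfl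

/-- the abelian-surface shape {0,0,1,1} is of WALL type (a repeated weight, no multiplicity ≥ 3) … -/
theorem abelianSurfaceShape_wall :
    (∀ w : ℤ, ({0, 0, 1, 1} : Multiset ℤ).count w ≤ 2) ∧ ¬ (∀ w : ℤ, ({0, 0, 1, 1} : Multiset ℤ).count w ≤ 1) := by
  refine ⟨fun w => ?_, fun h => by have := h 0; simp at this⟩
  by_cases h0 : w = 0
  · subst h0; decide
  · by_cases h1 : w = 1
    · subst h1; decide
    · rw [Multiset.count_eq_zero.mpr (by simp [h0, h1])]; omega

/-- … its exterior square has the Picard-rank-16 K3 shape {0,1,1,1,1,2} = (1,4,1) … -/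
theorem pairSums_abelianSurfaceShape : pairSums ({0, 0, 1, 1} : Multiset ℤ) = {0, 1, 1, 1, 1, 2} := by decide

/-- … which is DEGENERATE (the weight 1 has multiplicity 4 ≥ 3): ACC's population lies in D although its avatar lies in W … -/
theorem pairSums_abelianSurfaceShape_degenerate :
    (pairSums ({0, 0, 1, 1} : Multiset ℤ)).count 1 = 4 ∧ ¬ (∀ w : ℤ, (pairSums ({0, 0, 1, 1} : Multiset ℤ)).count w ≤ 2) := by
  have h4 : (pairSums ({0, 0, 1, 1} : Multiset ℤ)).count 1 = 4 := by decide
  exact ⟨h4, fun h => by have := h 1; omega⟩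

/-- … and removing the similitude weight ν = 1 leaves the Kummer / Picard-rank-17 K3 shape {0,1,1,1,2} = (1,3,1), still degenerate (SPIN's population). -/
theorem kummerShape : (pairSums ({0, 0, 1, 1} : Multiset ℤ)).erase 1 = {0, 1, 1, 1, 2} ∧ (({0, 1, 1, 1, 2} : Multiset ℤ)).count 1 = 3 := by
  constructor <;> decide

/-- the unitary-(3,1) shape {0,0,0,1} (itself degenerate, rank 4 < n: the IH's world) has exterior square {0,0,0,1,1,1} of shape (3,3): ACC ⊋ K3 type. -/
theorem pairSums_unitaryThreeOneShape : pairSums ({0, 0, 0, 1} : Multiset ℤ) = {0, 0, 0, 1, 1, 1} := by decide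

/-- a REGULAR avatar {0,1,2,3} gives the WALL shape {1,2,3,3,4,5} (multiplicity 2, not 3): that window belongs to the wall chamber W_Prim / R, NOT to
D_Prim — booked for the next generation (memo §12), certified here so that the two chambers' windows are not confused. -/
theorem pairSums_regularShape : pairSums ({0, 1, 2, 3} : Multiset ℤ) = {1, 2, 3, 3, 4, 5} ∧
    (∀ w : ℤ, (({1, 2, 3, 3, 4, 5} : Multiset ℤ)).count w ≤ 2) := by
  refine ⟨by decide, fun w => ?_⟩
  by_cases h1 : w = 1
  · subst h1; decide
  by_cases h2 : w = 2
  · subst h2; decide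
  by_cases h3 : w = 3
  · subst h3; decide
  by_cases h4 : w = 4
  · subst h4; decide
  by_cases h5 : w = 5
  · subst h5; decide
  rw [Multiset.count_eq_zero.mpr (by simp [h1, h2, h3, h4, h5])]; omega

end Certificates

/-! ## 3. Clause (B) restricted to a population, the IH (g10 VERBATIM structured forms) -/

section Clause

variable {n : ℕ} {F : Type} [Field F] [NumberField F]

/-- Clause (B) of the summit (`Summit.Langlands.GaloisToAutomorphic`, verbatim) for the `ρ` satisfying `Q`. -/
def GaloisToAutomorphicOn (Rd : Summit.Langlands.ReciprocityData F) (hcpt : Literature.NumberTheory.Automorphic.isCompact_glFiniteIntegralLevel n F)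
    (Q : ∀ (ℓ : ℕ) [Fact ℓ.Prime], Literature.NumberTheory.GaloisRepresentations.FramedGaloisRep F (PadicAlgCl ℓ) n → Prop) : Prop :=
  ∀ (ℓ : ℕ) [Fact ℓ.Prime] (ι : PadicAlgCl ℓ ≃+* ℂ) (ρ : Literature.NumberTheory.GaloisRepresentations.FramedGaloisRep F (PadicAlgCl ℓ) n),
    ρ.toGaloisRep.IsIrreducible → Summit.Langlands.IsGeometricFramed Rd ρ → Q ℓ ρ →
      ∃ π : Literature.NumberTheory.Automorphic.CuspidalAutomorphicRepData n F hcpt, π.1.IsLAlgebraic ∧ Summit.Langlands.Corresponds Rd ι π.1 ρ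

end Clause

/-- «reciprocity below rank n» (g10 `ReciprocityBelow` VERBATIM: the tree's `GlobalLanglandsCorrespondenceGLn` at every rank m < n over every number
field, datum and level) — the IH every D-cell carries. -/
def ReciprocityBelow (n : ℕ) : Prop :=
  ∀ (m : ℕ), m < n → 0 < m → ∀ (L : Type) [Field L] [NumberField L] (RdL : Summit.Langlands.ReciprocityData L)
    (hcptL : Literature.NumberTheory.Automorphic.isCompact_glFiniteIntegralLevel m L), Summit.Langlands.GlobalLanglandsCorrespondenceGLn m L RdL hcptL

/-! ## 4. The TARGET of record in structured form — certified `Iff.rfl` against the TREE declaration (identity of vocabulary and text) -/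

/-- the host target text ≡ the structured D_Prim form. -/
theorem target_iff : Summit.Langlands.Langlands.Theses.WeightMultiplicitySplit.DegenerateLieIrreducibleAutomorphy ↔
    (∀ (F : Type) [Field F] [NumberField F] (Rd : Summit.Langlands.ReciprocityData F) (n : ℕ), 0 < n →
      ∀ hcpt : Literature.NumberTheory.Automorphic.isCompact_glFiniteIntegralLevel n F,
        ReciprocityBelow n → GaloisToAutomorphicOn Rd hcpt (fun _ _ ρ => IsDegenerateHT ρ ∧ IsPrimitiveInfinite ρ)) := Iff.rfl

/-- the target's text VERBATIM (what the kit's items.json / the probes compare against). -/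
theorem target_text_iff : Summit.Langlands.Langlands.Theses.WeightMultiplicitySplit.DegenerateLieIrreducibleAutomorphy ↔ ∀ (F : Type) [Field F] [NumberField F] (Rd : Summit.Langlands.ReciprocityData F) (n : ℕ), 0 < n → ∀ hcpt : Literature.NumberTheory.Automorphic.isCompact_glFiniteIntegralLevel n F, (∀ (m : ℕ), m < n → 0 < m → ∀ (L : Type) [Field L] [NumberField L] (RdL : Summit.Langlands.ReciprocityData L) (hcptL : Literature.NumberTheory.Automorphic.isCompact_glFiniteIntegralLevel m L), Summit.Langlands.GlobalLanglandsCorrespondenceGLn m L RdL hcptL) → (∀ (ℓ : ℕ) [Fact ℓ.Prime] (ι : PadicAlgCl ℓ ≃+* ℂ) (ρ : Literature.NumberTheory.GaloisRepresentations.FramedGaloisRep F (PadicAlgCl ℓ) n), ρ.toGaloisRep.IsIrreducible → Summit.Langlands.IsGeometricFramed Rd ρ → ((¬ (∀ (v : IsDedekindDomain.HeightOneSpectrum (NumberField.RingOfIntegers F)) (hv : ((ℓ : ℕ) : NumberField.RingOfIntegers F) ∈ v.asIdeal) (τ : v.adicCompletion F →+* PadicAlgCl ℓ), Continuous τ → ∀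 w : ℤ, (ρ.labelledHodgeTateWeightsAt v (Literature.NumberTheory.PAdicHodge.fontainePstAdicCompletion v ℓ hv).algebra (Literature.NumberTheory.PAdicHodge.fontainePstAdicCompletion v ℓ hv).𝔅 τ).count w ≤ 2)) ∧ (¬ (∃ (L : Type) (_ : Field L) (_ : NumberField L) (_ : Algebra F L), ∀ σ : Field.absoluteGaloisGroup L, ∃ c : PadicAlgCl ℓ, ((ρ.restrictField L σ : GL (Fin n) (PadicAlgCl ℓ)) : Matrix (Fin n) (Fin n) (PadicAlgCl ℓ)) = c • (1 : Matrix (Fin n) (Fin n) (PadicAlgCl ℓ))) ∧ (∀ (L : Type) [Field L] [NumberField L] [Algebra F L], (ρ.restrictField L).toGaloisRep.IsIrreducible))) → ∃ π : Literature.NumberTheory.Automorphic.CuspidalAutomorphicRepData n F hcpt, π.1.IsLAlgebraic ∧ Summit.Langlands.Corresponds Rd ι π.1 ρ) := Iff.rfl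

/-! ## 5. THE THREE CELLS + THE FRAME (the items; inlined one-liners over existing tree declarations = childroute.items.json `statement` VERBATIM) -/

/-- SPIN · crux · WEAKER · ATTACKABLE-NOW (print mod the IH: Kim 2003 + Henniart 2009 + Asgari–Raghuram 2007 + the GL₁-constituent splitting + WD/D_pst of ∧²)
— THE ATTACKED CONJUNCT.  GIVEN reciprocity below rank n, clause (B) (full `Corresponds`) for the degenerate-type primitive ρ of rank n = 5 inside the
F-RATIONAL SYMPLECTIC-SPINOR WINDOW: (ρ ⊗ ψ) ⊕ ν ≅ ∧²σ on characteristic polynomials, σ a rank-4 irreducible pinned-geometric Lie-irreducible avatar,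
ψ, ν pinned-geometric characters (Kummer / Picard-rank-17 K3 type {2a,(a+c)³,2c} from abelian-surface / (k,2)-type σ, and its twists). -/
def DegenerateSpinorWindowTransport : Prop :=
  ∀ (F : Type) [Field F] [NumberField F] (Rd : Summit.Langlands.ReciprocityData F) (n : ℕ), 0 < n → ∀ hcpt : Literature.NumberTheory.Automorphic.isCompact_glFiniteIntegralLevel n F, (∀ (m : ℕ), m < n → 0 < m → ∀ (L : Type) [Field L] [NumberField L] (RdL : Summit.Langlands.ReciprocityData L) (hcptL : Literature.NumberTheory.Automorphic.isCompact_glFiniteIntegralLevel m L), Summit.Langlands.GlobalLanglandsCorrespondenceGLn m L RdL hcptL) → (∀ (ℓ : ℕ) [Fact ℓ.Prime] (ι : PadicAlgCl ℓ ≃+* ℂ) (ρ : Literature.NumberTheory.GaloisRepresentations.FramedGaloisRep F (PadicAlgCl ℓ) n), ρ.toGaloisRep.IsIrreducible → Summit.Langlands.IsGeometricFramed Rd ρ → (((¬ (∀ (v : IsDedekindDomain.HeightOneSpectrum (NumberField.RingOfIntegers F)) (hv : ((ℓ : ℕ) : NumberField.RingOfIntegers F) ∈ v.asIdeal) (τ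 : v.adicCompletion F →+* PadicAlgCl ℓ), Continuous τ → ∀ w : ℤ, (ρ.labelledHodgeTateWeightsAt v (Literature.NumberTheory.PAdicHodge.fontainePstAdicCompletion v ℓ hv).algebra (Literature.NumberTheory.PAdicHodge.fontainePstAdicCompletion v ℓ hv).𝔅 τ).count w ≤ 2)) ∧ (¬ (∃ (L : Type) (_ : Field L) (_ : NumberField L) (_ : Algebra F L), ∀ σ : Field.absoluteGaloisGroup L, ∃ c : PadicAlgCl ℓ, ((ρ.restrictField L σ : GL (Fin n) (PadicAlgCl ℓ)) : Matrix (Fin n) (Fin n) (PadicAlgCl ℓ)) = c • (1 : Matrix (Fin n) (Fin n) (PadicAlgCl ℓ))) ∧ (∀ (L : Type) [Field L] [NumberField L] [Algebra F L], (ρ.restrictField L).toGaloisRep.IsIrreducible))) ∧ (n = 5 ∧ ∃ (σ : Literature.NumberTheory.GaloisRepresentations.FramedGaloisRep F (PadicAlgCl ℓ) 4) (ψ ν : Literature.NumberTheory.GaloisRepresentations.FramedGaloisRep F (PadicAlgCl ℓ) 1), (σ.toGaloisRep.IsIrreducible ∧ Summit.Langlands.IsGeometricFramed Rd σ ∧ (∀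 (L : Type) [Field L] [NumberField L] [Algebra F L], (σ.restrictField L).toGaloisRep.IsIrreducible)) ∧ (Summit.Langlands.IsGeometricFramed Rd ψ ∧ Summit.Langlands.IsGeometricFramed Rd ν) ∧ ∀ g : Field.absoluteGaloisGroup F, (Literature.NumberTheory.GaloisRepresentations.FramedRep.charpoly ρ g).roots.map (fun x => Literature.NumberTheory.GaloisRepresentations.FramedRep.trace ψ g * x) + {Literature.NumberTheory.GaloisRepresentations.FramedRep.trace ν g} = (((Literature.NumberTheory.GaloisRepresentations.FramedRep.charpoly σ g).roots.powersetCard 2).map Multiset.prod))) → ∃ π : Literature.NumberTheory.Automorphic.CuspidalAutomorphicRepData n F hcpt, π.1.IsLAlgebraic ∧ Summit.Langlands.Corresponds Rd ι π.1 ρ)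

/-- ACC · crux · WEAKER · ATTACKABLE-NOW (print mod the IH: Kim 2003 + Henniart 2009 + Asgari–Raghuram 2007 + WD/D_pst of ∧²) — second attacked conjunct.
GIVEN reciprocity below rank n, clause (B) (full `Corresponds`) for the degenerate-type primitive ρ of rank n = 6 inside the F-RATIONAL PLÜCKER WINDOW:
ρ ≅ ∧²σ ⊗ χ on characteristic polynomials, σ a rank-4 irreducible pinned-geometric Lie-irreducible avatar, χ a pinned-geometric character (Picard-rank-16
K3 type {2a,(a+c)⁴,2c} from abelian-surface-type σ, shape {2a³,(a+d)³} from unitary-(3,1)-type σ, and twists). -/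
def DegenerateExteriorSquareWindowTransport : Prop :=
  ∀ (F : Type) [Field F] [NumberField F] (Rd : Summit.Langlands.ReciprocityData F) (n : ℕ), 0 < n → ∀ hcpt : Literature.NumberTheory.Automorphic.isCompact_glFiniteIntegralLevel n F, (∀ (m : ℕ), m < n → 0 < m → ∀ (L : Type) [Field L] [NumberField L] (RdL : Summit.Langlands.ReciprocityData L) (hcptL : Literature.NumberTheory.Automorphic.isCompact_glFiniteIntegralLevel m L), Summit.Langlands.GlobalLanglandsCorrespondenceGLn m L RdL hcptL) → (∀ (ℓ : ℕ) [Fact ℓ.Prime] (ι : PadicAlgCl ℓ ≃+* ℂ) (ρ : Literature.NumberTheory.GaloisRepresentations.FramedGaloisRep F (PadicAlgCl ℓ) n), ρ.toGaloisRep.IsIrreducible → Summit.Langlands.IsGeometricFramed Rd ρ → (((¬ (∀ (v : IsDedekindDomain.HeightOneSpectrum (NumberField.RingOfIntegers F)) (hv : ((ℓ : ℕ) : NumberField.RingOfIntegers F) ∈ v.asIdeal) (τ : v.adicCompletion F →+* PadicAlgCl ℓ), Continuous τ → ∀ w : ℤ, (ρ.labelledHodgeTateWeightsAt v (Literature.NumberTheory.PAdicHodge.fontainePstAdicCompletion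 v ℓ hv).algebra (Literature.NumberTheory.PAdicHodge.fontainePstAdicCompletion v ℓ hv).𝔅 τ).count w ≤ 2)) ∧ (¬ (∃ (L : Type) (_ : Field L) (_ : NumberField L) (_ : Algebra F L), ∀ σ : Field.absoluteGaloisGroup L, ∃ c : PadicAlgCl ℓ, ((ρ.restrictField L σ : GL (Fin n) (PadicAlgCl ℓ)) : Matrix (Fin n) (Fin n) (PadicAlgCl ℓ)) = c • (1 : Matrix (Fin n) (Fin n) (PadicAlgCl ℓ))) ∧ (∀ (L : Type) [Field L] [NumberField L] [Algebra F L], (ρ.restrictField L).toGaloisRep.IsIrreducible))) ∧ (n = 6 ∧ ∃ (σ : Literature.NumberTheory.GaloisRepresentations.FramedGaloisRep F (PadicAlgCl ℓ) 4) (χ : Literature.NumberTheory.GaloisRepresentations.FramedGaloisRep F (PadicAlgCl ℓ) 1), (σ.toGaloisRep.IsIrreducible ∧ Summit.Langlands.IsGeometricFramed Rd σ ∧ (∀ (L : Type) [Field L] [NumberField L] [Algebra F L], (σ.restrictField L).toGaloisRep.IsIrreducible)) ∧ Summit.Langlands.IsGeometricFramed Rd χ ∧ ∀ g : Field.absoluteGaloisGroup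 F, (Literature.NumberTheory.GaloisRepresentations.FramedRep.charpoly ρ g).roots = ((((Literature.NumberTheory.GaloisRepresentations.FramedRep.charpoly σ g).roots.powersetCard 2).map Multiset.prod).map (fun x => Literature.NumberTheory.GaloisRepresentations.FramedRep.trace χ g * x)))) → ∃ π : Literature.NumberTheory.Automorphic.CuspidalAutomorphicRepData n F hcpt, π.1.IsLAlgebraic ∧ Summit.Langlands.Corresponds Rd ι π.1 ρ)

/-- RES · crux · WEAKER · BARRIER (NonRegularWeight head-on: no family witness, no accidental avatar) · IDEA-NEEDED = DECLARED RESIDUAL.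
GIVEN reciprocity below rank n, clause (B) for the degenerate-type primitive ρ with NO F-rational spinor window and NO F-rational Plücker window:
abelian g-folds g ≥ 3 ({0^g,1^g}, Sp_2g standard), K3 type of rank ≥ 7 (SO(2,m), m ≥ 5: no accident), Calabi–Yau threefolds with h^{2,1} ≥ 3, irregular
unitary U(a,b) type of rank ≥ 5 (and rank ≤ 4), every non-accidental Lie type, potential-only windows, ghosts. -/
def WindowlessDegenerateAutomorphy : Prop :=
  ∀ (F : Type) [Field F] [NumberField F] (Rd : Summit.Langlands.ReciprocityData F) (n : ℕ), 0 < n → ∀ hcpt : Literature.NumberTheory.Automorphic.isCompact_glFiniteIntegralLevel n F, (∀ (m : ℕ), m < n → 0 < m → ∀ (L : Type) [Field L] [NumberField L] (RdL : Summit.Langlands.ReciprocityData L) (hcptL : Literature.NumberTheory.Automorphic.isCompact_glFiniteIntegralLevel m L), Summit.Langlands.GlobalLanglandsCorrespondenceGLn m L RdL hcptL) → (∀ (ℓ : ℕ) [Fact ℓ.Prime] (ι : PadicAlgCl ℓ ≃+* ℂ) (ρ : Literature.NumberTheory.GaloisRepresentations.FramedGaloisRep F (PadicAlgCl ℓ)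 n), ρ.toGaloisRep.IsIrreducible → Summit.Langlands.IsGeometricFramed Rd ρ → (((¬ (∀ (v : IsDedekindDomain.HeightOneSpectrum (NumberField.RingOfIntegers F)) (hv : ((ℓ : ℕ) : NumberField.RingOfIntegers F) ∈ v.asIdeal) (τ : v.adicCompletion F →+* PadicAlgCl ℓ), Continuous τ → ∀ w : ℤ, (ρ.labelledHodgeTateWeightsAt v (Literature.NumberTheory.PAdicHodge.fontainePstAdicCompletion v ℓ hv).algebra (Literature.NumberTheory.PAdicHodge.fontainePstAdicCompletion v ℓ hv).𝔅 τ).count w ≤ 2)) ∧ (¬ (∃ (L : Type) (_ : Field L) (_ : NumberField L) (_ : Algebra F L), ∀ σ : Field.absoluteGaloisGroup L, ∃ c : PadicAlgCl ℓ, ((ρ.restrictField L σ : GL (Fin n) (PadicAlgCl ℓ)) : Matrix (Fin n) (Fin n) (PadicAlgCl ℓ)) = c • (1 : Matrix (Fin n) (Fin n) (PadicAlgCl ℓ))) ∧ (∀ (L : Type) [Field L] [NumberField L] [Algebra F L], (ρ.restrictField L).toGaloisRep.IsIrreducible))) ∧ (¬ (n = 5 ∧ ∃ (σ : Literature.NumberTheory.GaloisRepresentations.FramedGaloisRep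 F (PadicAlgCl ℓ) 4) (ψ ν : Literature.NumberTheory.GaloisRepresentations.FramedGaloisRep F (PadicAlgCl ℓ) 1), (σ.toGaloisRep.IsIrreducible ∧ Summit.Langlands.IsGeometricFramed Rd σ ∧ (∀ (L : Type) [Field L] [NumberField L] [Algebra F L], (σ.restrictField L).toGaloisRep.IsIrreducible)) ∧ (Summit.Langlands.IsGeometricFramed Rd ψ ∧ Summit.Langlands.IsGeometricFramed Rd ν) ∧ ∀ g : Field.absoluteGaloisGroup F, (Literature.NumberTheory.GaloisRepresentations.FramedRep.charpoly ρ g).roots.map (fun x => Literature.NumberTheory.GaloisRepresentations.FramedRep.trace ψ g * x) + {Literature.NumberTheory.GaloisRepresentations.FramedRep.trace ν g} = (((Literature.NumberTheory.GaloisRepresentations.FramedRep.charpoly σ g).roots.powersetCard 2).map Multiset.prod)) ∧ ¬ (n = 6 ∧ ∃ (σ : Literature.NumberTheory.GaloisRepresentations.FramedGaloisRep F (PadicAlgCl ℓ) 4) (χ : Literature.NumberTheory.GaloisRepresentations.FramedGaloisRep F (PadicAlgCl ℓ) 1), (σ.toGaloisRep.IsIrreducible ∧ Summit.Langlands.IsGeometricFramed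 Rd σ ∧ (∀ (L : Type) [Field L] [NumberField L] [Algebra F L], (σ.restrictField L).toGaloisRep.IsIrreducible)) ∧ Summit.Langlands.IsGeometricFramed Rd χ ∧ ∀ g : Field.absoluteGaloisGroup F, (Literature.NumberTheory.GaloisRepresentations.FramedRep.charpoly ρ g).roots = ((((Literature.NumberTheory.GaloisRepresentations.FramedRep.charpoly σ g).roots.powersetCard 2).map Multiset.prod).map (fun x => Literature.NumberTheory.GaloisRepresentations.FramedRep.trace χ g * x))))) → ∃ π : Literature.NumberTheory.Automorphic.CuspidalAutomorphicRepData n F hcpt, π.1.IsLAlgebraic ∧ Summit.Langlands.Corresponds Rd ι π.1 ρ)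

/-- FRAME · support · the HOST ROUTE around D_Prim, as one implication BY NAME: `Summit.Langlands.Langlands.Theses.WeightMultiplicitySplit.DegenerateLieIrreducibleAutomorphy → Langlands`.
Certified from the host's `closes`, the two landed split glues and the host items G, W (or its leaves), D_A, D_Fin, D_Str (`frame_of_host`,
`frame_of_host_leaves`); trivially from Langlands. -/
def DegenerateLieIrreducibleFrame : Prop :=
  Summit.Langlands.Langlands.Theses.WeightMultiplicitySplit.DegenerateLieIrreducibleAutomorphy → _root_.Langlands

/-! ## 6. Identity of the items with the structured forms (`Iff.rfl` ×3) -/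

/-- SPIN item text ≡ its structured form. -/
theorem degenerateSpinorWindowTransport_iff : DegenerateSpinorWindowTransport ↔
    (∀ (F : Type) [Field F] [NumberField F] (Rd : Summit.Langlands.ReciprocityData F) (n : ℕ), 0 < n →
      ∀ hcpt : Literature.NumberTheory.Automorphic.isCompact_glFiniteIntegralLevel n F,
        ReciprocityBelow n →
          GaloisToAutomorphicOn Rd hcpt (fun _ _ ρ => (IsDegenerateHT ρ ∧ IsPrimitiveInfinite ρ) ∧ IsSpinorWindow Rd ρ)) := Iff.rfl

/-- ACC item text ≡ its structured form. -/
theorem degenerateExteriorSquareWindowTransport_iff : DegenerateExteriorSquareWindowTransport ↔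
    (∀ (F : Type) [Field F] [NumberField F] (Rd : Summit.Langlands.ReciprocityData F) (n : ℕ), 0 < n →
      ∀ hcpt : Literature.NumberTheory.Automorphic.isCompact_glFiniteIntegralLevel n F,
        ReciprocityBelow n →
          GaloisToAutomorphicOn Rd hcpt (fun _ _ ρ => (IsDegenerateHT ρ ∧ IsPrimitiveInfinite ρ) ∧ IsExteriorSquareWindow Rd ρ)) := Iff.rfl

/-- RES item text ≡ its structured form. -/
theorem windowlessDegenerateAutomorphy_iff : WindowlessDegenerateAutomorphy ↔
    (∀ (F : Type) [Field F] [NumberField F] (Rd : Summit.Langlands.ReciprocityData F) (n : ℕ), 0 < n →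
      ∀ hcpt : Literature.NumberTheory.Automorphic.isCompact_glFiniteIntegralLevel n F,
        ReciprocityBelow n →
          GaloisToAutomorphicOn Rd hcpt (fun _ _ ρ => (IsDegenerateHT ρ ∧ IsPrimitiveInfinite ρ) ∧ IsWindowless Rd ρ)) := Iff.rfl

/-! ## 7. KERNEL: exactness of the split, necessity, the frame, the deciding theorem -/

/-- D_Prim ⟹ each cell (every cell is D_Prim with an extra hypothesis). -/
theorem cells_of_degenerateLieIrreducible (hP : Summit.Langlands.Langlands.Theses.WeightMultiplicitySplit.DegenerateLieIrreducibleAutomorphy) :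
    DegenerateSpinorWindowTransport ∧ DegenerateExteriorSquareWindowTransport ∧ WindowlessDegenerateAutomorphy :=
  ⟨fun F _ _ Rd n hn hcpt hIH ℓ _ ι ρ hirr hgeo hQ => hP F Rd n hn hcpt hIH ℓ ι ρ hirr hgeo hQ.1,
   fun F _ _ Rd n hn hcpt hIH ℓ _ ι ρ hirr hgeo hQ => hP F Rd n hn hcpt hIH ℓ ι ρ hirr hgeo hQ.1,
   fun F _ _ Rd n hn hcpt hIH ℓ _ ι ρ hirr hgeo hQ => hP F Rd n hn hcpt hIH ℓ ι ρ hirr hgeo hQ.1⟩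

/-- the cells ⟹ D_Prim: excluded middle on the two inlined dials (= `childroute.glue.lean`'s body). -/
theorem degenerateLieIrreducible_of_cells (hS : DegenerateSpinorWindowTransport) (hA : DegenerateExteriorSquareWindowTransport)
    (hR : WindowlessDegenerateAutomorphy) : Summit.Langlands.Langlands.Theses.WeightMultiplicitySplit.DegenerateLieIrreducibleAutomorphy := by
  intro F _ _ Rd n hn hcpt hIH ℓ _ ι ρ hirr hgeo hQ
  refine Classical.byCases (fun h5 => hS F Rd n hn hcpt hIH ℓ ι ρ hirr hgeo ⟨hQ, h5⟩) (fun h5 => ?_)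
  refine Classical.byCases (fun h6 => hA F Rd n hn hcpt hIH ℓ ι ρ hirr hgeo ⟨hQ, h6⟩) (fun h6 => ?_)
  exact hR F Rd n hn hcpt hIH ℓ ι ρ hirr hgeo ⟨hQ, h5, h6⟩

/-- **EXACTNESS, mod NOTHING**: D_Prim ⟺ SPIN ∧ ACC ∧ RES. -/
theorem degenerateLieIrreducible_iff_cells : Summit.Langlands.Langlands.Theses.WeightMultiplicitySplit.DegenerateLieIrreducibleAutomorphy ↔
    DegenerateSpinorWindowTransport ∧ DegenerateExteriorSquareWindowTransport ∧ WindowlessDegenerateAutomorphy :=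
  ⟨cells_of_degenerateLieIrreducible, fun h => degenerateLieIrreducible_of_cells h.1 h.2.1 h.2.2⟩

/-- the D-feed of the host split is implied by the host's G ∧ W (g10 `multiplicityTwoRankStep_of`, re-proved over the tree decls). -/
theorem multiplicityTwoRankStep_of (hG : Summit.Langlands.Langlands.Theses.WeightMultiplicitySplit.GenericWeightReciprocity) (hW : Summit.Langlands.Langlands.Theses.WeightMultiplicitySplit.WallWeightReciprocity) :
    Summit.Langlands.Langlands.Theses.WeightMultiplicitySplit.MultiplicityTwoRankStep := by
  intro F _ _ Rd n hn hcpt _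
  refine ⟨?_, ?_⟩
  · intro π hπ h2 ℓ _ ι
    by_cases h1 : (∃ T : Literature.NumberTheory.Automorphic.InfinityType F n, π.1.HasInfinityType T ∧ ∀ (σ : F →+* ℂ) (a : ℂ), ((T σ).map Literature.NumberTheory.Automorphic.ArchWeight.a).count a ≤ 1)
    · exact ((hG F).2 Rd n hn hcpt).1 π hπ h1 ℓ ι
    · exact ((hW F).2 Rd n hn hcpt).1 π hπ ⟨h1, h2⟩ ℓ ι
  · intro ℓ _ ι ρ hirr hgeo h2
    by_cases h1 : (∀ (v : IsDedekindDomain.HeightOneSpectrum (NumberField.RingOfIntegers F)) (hv : ((ℓ : ℕ) : NumberField.RingOfIntegers F) ∈ v.asIdeal) (τ : v.adicCompletion F →+* PadicAlgCl ℓ), Continuous τ → ∀ w : ℤ, (ρ.labelledHodgeTateWeightsAt v (Literature.NumberTheory.PAdicHodge.fontainePstAdicCompletion v ℓ hv).algebra (Literature.NumberTheory.PAdicHodge.fontainePstAdicCompletion v ℓ hv).𝔅 τ).count w ≤ 1)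
    · exact ((hG F).2 Rd n hn hcpt).2 ℓ ι ρ hirr hgeo h1
    · exact ((hW F).2 Rd n hn hcpt).2 ℓ ι ρ hirr hgeo ⟨h1, h2⟩

-- the W-feed of the host split is the host's G in IH form: LANDED as `Theorems.WeightMultiplicitySplitMinusculeHodgeType.genericRankStep_of_generic` (reused by name).

/-- **THE FRAME IS THE HOST ROUTE**: G, W, D_A, D_Fin, D_Str (host items BY NAME) ⟹ (D_Prim → Langlands), through the LANDED glue
`Theorems.WeightMultiplicitySplit_DegenerateWeightReciprocity_of_split_proof` (item 33711, CLOSED) and the host's certified `Summit.Langlands.Langlands.Theses.WeightMultiplicitySplit.closes`. -/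
theorem frame_of_host (hG : Summit.Langlands.Langlands.Theses.WeightMultiplicitySplit.GenericWeightReciprocity) (hW : Summit.Langlands.Langlands.Theses.WeightMultiplicitySplit.WallWeightReciprocity)
    (hDA : Summit.Langlands.Langlands.Theses.WeightMultiplicitySplit.DegenerateAutomorphicToGalois) (hDF : Summit.Langlands.Langlands.Theses.WeightMultiplicitySplit.DegenerateArtinTypeAutomorphy)
    (hDS : Summit.Langlands.Langlands.Theses.WeightMultiplicitySplit.DegenerateStructuredAutomorphy) : DegenerateLieIrreducibleFrame := fun hP =>
  Summit.Langlands.Langlands.Theses.WeightMultiplicitySplit.closes hG hW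
    (Summit.Langlands.Langlands.Theorems.WeightMultiplicitySplit_DegenerateWeightReciprocity_of_split_proof hDA hDF hDS hP
      (multiplicityTwoRankStep_of hG hW))

/-- the frame over the host's LEAVES (W replaced by its four children through the other landed glue, item 33607): what the forest below W and D
contributes around D_Prim, by name. -/
theorem frame_of_host_leaves (hG : Summit.Langlands.Langlands.Theses.WeightMultiplicitySplit.GenericWeightReciprocity) (hWA : Summit.Langlands.Langlands.Theses.WeightMultiplicitySplit.WallAutomorphicToGalois)
    (hWF : Summit.Langlands.Langlands.Theses.WeightMultiplicitySplit.WallArtinTypeAutomorphy) (hWS : Summit.Langlands.Langlands.Theses.WeightMultiplicitySplit.WallStructuredAutomorphy)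
    (hWP : Summit.Langlands.Langlands.Theses.WeightMultiplicitySplit.WallLieIrreducibleAutomorphy) (hDA : Summit.Langlands.Langlands.Theses.WeightMultiplicitySplit.DegenerateAutomorphicToGalois)
    (hDF : Summit.Langlands.Langlands.Theses.WeightMultiplicitySplit.DegenerateArtinTypeAutomorphy) (hDS : Summit.Langlands.Langlands.Theses.WeightMultiplicitySplit.DegenerateStructuredAutomorphy) :
    DegenerateLieIrreducibleFrame :=
  frame_of_host hG
    (Summit.Langlands.Langlands.Theorems.WeightMultiplicitySplit_WallWeightReciprocity_of_split_proof hWA hWF hWS hWP (Summit.Langlands.Langlands.Theorems.WeightMultiplicitySplitMinusculeHodgeType.genericRankStep_of_generic hG))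
    hDA hDF hDS

/-- the frame is (trivially) implied by the summit. -/
theorem frame_of_langlands (h : _root_.Langlands) : DegenerateLieIrreducibleFrame := fun _ => h

/-- NECESSITY: the target is implied by the summit (one line over the tree's `GlobalLanglandsCorrespondenceGLn`) … -/
theorem degenerateLieIrreducible_of_langlands (h : _root_.Langlands) : Summit.Langlands.Langlands.Theses.WeightMultiplicitySplit.DegenerateLieIrreducibleAutomorphy := by
  intro F _ _ Rd n hn hcpt _ ℓ _ ι ρ hirr hgeo _
  obtain ⟨_, hB⟩ := (h F).2 Rd n hn hcpt
  exact hB ℓ ι ρ hirr hgeo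

/-- … hence so is every cell (no strengthening anywhere). -/
theorem degenerateSpinorWindowTransport_of_langlands (h : _root_.Langlands) : DegenerateSpinorWindowTransport :=
  (cells_of_degenerateLieIrreducible (degenerateLieIrreducible_of_langlands h)).1
/-- ACC is implied by the summit. -/
theorem degenerateExteriorSquareWindowTransport_of_langlands (h : _root_.Langlands) : DegenerateExteriorSquareWindowTransport :=
  (cells_of_degenerateLieIrreducible (degenerateLieIrreducible_of_langlands h)).2.1
/-- RES (the declared residual) is implied by the summit. -/
theorem windowlessDegenerateAutomorphy_of_langlands (h : _root_.Langlands) : WindowlessDegenerateAutomorphy :=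
  (cells_of_degenerateLieIrreducible (degenerateLieIrreducible_of_langlands h)).2.2

/-- **DECIDING THEOREM of the child route** (= `childroute.glue.lean` VERBATIM): the three cells and the frame ⟹ `_root_.Langlands` BY NAME. -/
theorem closes (hS : DegenerateSpinorWindowTransport) (hA : DegenerateExteriorSquareWindowTransport) (hR : WindowlessDegenerateAutomorphy)
    (hF : DegenerateLieIrreducibleFrame) : _root_.Langlands := by
  refine hF ?_
  intro F _ _ Rd n hn hcpt hIH ℓ _ ι ρ hirr hgeo hQ
  refine Classical.byCases (fun h5 => hS F Rd n hn hcpt hIH ℓ ι ρ hirr hgeo ⟨hQ, h5⟩) (fun h5 => ?_)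
  refine Classical.byCases (fun h6 => hA F Rd n hn hcpt hIH ℓ ι ρ hirr hgeo ⟨hQ, h6⟩) (fun h6 => ?_)
  exact hR F Rd n hn hcpt hIH ℓ ι ρ hirr hgeo ⟨hQ, h5, h6⟩

/-- the deciding theorem with the HOST ITEMS in place of the frame (what the child route decides, spelled over the host route's items). -/
theorem closes_host_shape (hG : Summit.Langlands.Langlands.Theses.WeightMultiplicitySplit.GenericWeightReciprocity) (hW : Summit.Langlands.Langlands.Theses.WeightMultiplicitySplit.WallWeightReciprocity)
    (hDA : Summit.Langlands.Langlands.Theses.WeightMultiplicitySplit.DegenerateAutomorphicToGalois) (hDF : Summit.Langlands.Langlands.Theses.WeightMultiplicitySplit.DegenerateArtinTypeAutomorphy)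
    (hDS : Summit.Langlands.Langlands.Theses.WeightMultiplicitySplit.DegenerateStructuredAutomorphy)
    (hS : DegenerateSpinorWindowTransport) (hA : DegenerateExteriorSquareWindowTransport) (hR : WindowlessDegenerateAutomorphy) :
    _root_.Langlands :=
  closes hS hA hR (frame_of_host hG hW hDA hDF hDS)

/-- **EXACTNESS of the child route, mod NOTHING**: Langlands ⟺ (SPIN ∧ ACC ∧ RES) ∧ FRAME. -/
theorem langlands_iff_pieces : _root_.Langlands ↔
    (DegenerateSpinorWindowTransport ∧ DegenerateExteriorSquareWindowTransport ∧ WindowlessDegenerateAutomorphy) ∧ DegenerateLieIrreducibleFrame :=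
  ⟨fun h => ⟨cells_of_degenerateLieIrreducible (degenerateLieIrreducible_of_langlands h), frame_of_langlands h⟩,
   fun h => closes h.1.1 h.1.2.1 h.1.2.2 h.2⟩

/-- the IH every cell carries is itself implied by the summit (no cell is vacuously true under Langlands by a false antecedent). -/
theorem reciprocityBelow_of_langlands (h : _root_.Langlands) (n : ℕ) : ReciprocityBelow n :=
  fun m _ hm0 L _ _ RdL hcptL => (h L).2 RdL m hm0 hcptL

/-- the frame is also EQUIVALENT to «D_Prim → Langlands» spelled through the cells (bookkeeping: FRAME carries no content beyond the host route). -/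
theorem frame_iff_cells_imp : DegenerateLieIrreducibleFrame ↔
    (DegenerateSpinorWindowTransport → DegenerateExteriorSquareWindowTransport → WindowlessDegenerateAutomorphy → _root_.Langlands) :=
  ⟨fun hF hS hA hR => closes hS hA hR hF, fun h hP => by
    obtain ⟨hS, hA, hR⟩ := cells_of_degenerateLieIrreducible hP; exact h hS hA hR⟩

end Summit.Langlands.Langlands.Theorems.WeightMultiplicitySplitDegenerateWindow
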